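import Summits.QuantumFields.YangMills.Theorems.LuscherReductionOneSiteLevelsKacRemainder
import Literature.Analysis.OperatorTheory.YangMillsMatrixModelDiscreteness

/-!
# INNER, flat lane (layer III): the flat Kac-form bound from AL1 — `stub_flatKacAL1` (III.11)

Support module of crux `OneSiteLevels` (route `LuscherReduction`, item stmt-QuantumFields-20007): the registered v12 stub
`stub_flatKacAL1 : (∀ k, LuscherHamiltonianEigenfunctions k) → ∀ k, FlatKacFormBound k` of the birth line, FLAT lane
(STUB-PLAN rev 3 rows III.8–III.11).

Assembly.  Fix `k`, `κ > 0`, `E_k = physLevel (k+1)`.  By `tendsto_physLevel_atTop` choose `m ≥ k` with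
`physLevel (m+2) ≥ E_k + 96κ² + 3`; let `f_0,…,f_m` be the AL1 family and take the constraint functions `fs_i = f_i` (`i < k`).
For a datum `g ⊥ f_0,…,f_{k-1}` write `g = F + r`, `F = Σ_j ⟨g,f_j⟩ f_j`, and expand
`kacForm t g = kacForm t F + 2 kacBil t F r + kacForm t r` (`kacForm_add`):
* span (III.8, `kacForm_span_ge`): `kacForm t F ≥ Σ c_j² E_j − K t Σ c_j² ≥ E_k Σ c_j² − K t Σ c_j²` (`c_j = 0` for `j < k`);
* cross (III.9, `abs_kacBil_span_le`): `2|kacBil t F r| ≤ 2 C √t ‖c‖ ‖r‖ ≤ C² t Σ c_j² + ‖r‖²`;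
* remainder (III.10, `kacForm_remainder_ge`): `kacForm t r ≥ (E_k + 2)‖r‖² − D₀ t Σ c_j²`.
Summing and using Pythagoras `‖g‖² = ‖r‖² + Σ c_j²`: `kacForm t g ≥ (E_k − (K + C² + D₀) t) ‖g‖²`.

Real analysis only ([folklore] assembly; [cite: SimonB1983DiscreteSpectrum, §3]); femto rung R2b1; NOT a claim about the gap.
-/

set_option autoImplicit false

noncomputable section

open MeasureTheory Filter Topology Real
open Literature.Analysis.OperatorTheory.YMMatrixModel

namespace Summit.QuantumFields.YangMills.Theorems.FemtoTransferGap

section Assembly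

variable {m : ℕ} {f : Fin (m + 1) → ZM → ℝ}

/-- On the span: if `c_j = 0` for `j < k` then `E_k Σ c_j² ≤ Σ c_j² E_j` (monotonicity of `physLevel`). [folklore] -/
theorem physLevel_mul_sum_sq_le {k : ℕ} (c : Fin (m + 1) → ℝ) (hc0 : ∀ j : Fin (m + 1), (j : ℕ) < k → c j = 0) :
    physLevel (k + 1) * ∑ j, c j ^ 2 ≤ ∑ j, c j ^ 2 * physLevel ((j : ℕ) + 1) := by
  rw [Finset.mul_sum]
  refine Finset.sum_le_sum fun j _ => ?_
  by_cases hj : (j : ℕ) < k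
  · simp [hc0 j hj]
  · rw [mul_comm]
    exact mul_le_mul_of_nonneg_left (physLevel_mono (by omega) (by omega)) (sq_nonneg _)

/-- `2 C √t √S √X ≤ C² t S + X` (AM–GM) for `t, S, X ≥ 0`. [folklore] -/
theorem two_mul_sqrt_bound {C t S X : ℝ} (ht : 0 ≤ t) (hS : 0 ≤ S) (hX : 0 ≤ X) :
    2 * (C * Real.sqrt t * Real.sqrt S * Real.sqrt X) ≤ C ^ 2 * t * S + X := by
  have h1 : Real.sqrt t ^ 2 = t := Real.sq_sqrt ht
  have h2 : Real.sqrt S ^ 2 = S := Real.sq_sqrt hS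
  have h3 : Real.sqrt X ^ 2 = X := Real.sq_sqrt hX
  have key : 0 ≤ (C * Real.sqrt t * Real.sqrt S - Real.sqrt X) ^ 2 := sq_nonneg _
  have expand : (C * Real.sqrt t * Real.sqrt S - Real.sqrt X) ^ 2 =
      C ^ 2 * Real.sqrt t ^ 2 * Real.sqrt S ^ 2 - 2 * (C * Real.sqrt t * Real.sqrt S * Real.sqrt X) + Real.sqrt X ^ 2 := by ring
  rw [expand, h1, h2, h3] at key
  linarith

/-- **III.11 at a fixed family.**  For an AL1 eigenfamily `f_0,…,f_m`, `k ≤ m+1`, `κ > 0` and a window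
`physLevel (k+1) + 96κ² + 3 ≤ physLevel (m+2)`: there are `C`, `t₀ > 0` with
`(physLevel (k+1) − C t) ∫ g² ≤ kacForm t g` for `0 < t ≤ t₀` and every datum `g ⊥ f_0,…,f_{k-1}` of `FlatKacFormBound`.
[cite: SimonB1983DiscreteSpectrum, §3] -/
theorem flatKac_window (hf : IsEigenFamily m f) {k : ℕ} {κ : ℝ}
    (hgap : physLevel (k + 1) + 96 * κ ^ 2 + 3 ≤ physLevel (m + 2)) :
    ∃ C t₀ : ℝ, 0 < t₀ ∧ ∀ t : ℝ, 0 < t → t ≤ t₀ → ∀ g : ZM → ℝ, Measurable g → (∃ M : ℝ, ∀ x, |g x| ≤ M) →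
      IsGaugeInv g → (∀ x, g x ≠ 0 → ‖x‖ ≤ κ / Real.sqrt t) → (∀ j : Fin (m + 1), (j : ℕ) < k → ∫ x, g x * f j x = 0) →
        (physLevel (k + 1) - C * t) * ∫ x, g x ^ 2 ≤ kacForm t g := by
  obtain ⟨K, hK0, hK⟩ := kacForm_span_ge hf
  obtain ⟨Cc, hCc0, hCc⟩ := abs_kacBil_span_le hf
  obtain ⟨t₀, D₀, ht₀, hD₀, hR⟩ := kacForm_remainder_ge hf (E := physLevel (k + 1)) (κ := κ) (physLevel_nonneg (by omega)) hgap
  refine ⟨K + Cc ^ 2 + D₀, t₀, ht₀, fun t ht htt₀ g hgm hgM hginv hsupp horth => ?_⟩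
  obtain ⟨M, hgb⟩ := hgM
  set c : Fin (m + 1) → ℝ := fun j => ∫ x, g x * f j x with hcdef
  have hc : ∀ j, c j = ∫ x, g x * f j x := fun j => rfl
  obtain ⟨hrm, ⟨M', hrb⟩, hri, -, -, hrV, hVFr, horthr, hpyth⟩ := remainder_package hf hgm hgb hsupp hginv c hc
  -- the span `F`
  have hFK : IsKacFn (eigSpan f c) := by rw [eigSpan_eq]; exact isKacFn_span hf c
  obtain ⟨CF, -, hCF⟩ := hFK.exists_bound
  have hFb : ∀ x, |eigSpan f c x| ≤ CF := fun x => (hCF x).1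
  have hFm : Measurable (eigSpan f c) := hFK.continuous.measurable
  -- the decomposition of the Kac form
  have hsplit : kacForm t g = kacForm t (eigSpan f c) + 2 * kacBil t (eigSpan f c) (g - eigSpan f c) +
      kacForm t (g - eigSpan f c) := by
    have e : g = eigSpan f c + (g - eigSpan f c) := (add_sub_cancel (eigSpan f c) g).symm
    conv_lhs => rw [e]
    exact kacForm_add ht hFm hrm hFb hrb hFK.integrable hri hFK.integrable_potential_sq hrV hVFr
  -- (a) span
  have hc0 : ∀ j : Fin (m + 1), (j : ℕ) < k → c j = 0 := fun j hj => horth j hj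
  have hS0 : (0 : ℝ) ≤ ∑ j, c j ^ 2 := Finset.sum_nonneg fun j _ => sq_nonneg _
  have hX0 : 0 ≤ ∫ x, (g - eigSpan f c) x ^ 2 := integral_nonneg fun x => sq_nonneg _
  have ha : physLevel (k + 1) * (∑ j, c j ^ 2) - K * t * ∑ j, c j ^ 2 ≤ kacForm t (eigSpan f c) := by
    have h := hK t ht c
    rw [← eigSpan_eq] at h
    linarith [physLevel_mul_sum_sq_le c hc0]
  -- (b) cross
  have hb : -(Cc ^ 2 * t * (∑ j, c j ^ 2) + ∫ x, (g - eigSpan f c) x ^ 2) ≤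
      2 * kacBil t (eigSpan f c) (g - eigSpan f c) := by
    have h := hCc t ht c (g - eigSpan f c) hrm M' hrb hri horthr
    rw [← eigSpan_eq] at h
    have h2 := two_mul_sqrt_bound (C := Cc) ht.le hS0 hX0
    have h3 := neg_abs_le (kacBil t (eigSpan f c) (g - eigSpan f c))
    linarith
  -- (c) remainder
  have hcR := hR t ht htt₀ g M c hgm hgb hginv hsupp hc
  -- sum up
  have hg2 : ∫ x, g x ^ 2 = (∫ x, (g - eigSpan f c) x ^ 2) + ∑ j, c j ^ 2 := hpyth
  rw [hsplit, hg2]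
  have hKt : 0 ≤ (K + Cc ^ 2 + D₀) * t * ∫ x, (g - eigSpan f c) x ^ 2 := by positivity
  nlinarith [ha, hb, hcR, hKt]

/-- **III.11 — the flat Kac-form bound from AL1.**  `(∀ k, AL1 k) → ∀ k, FlatKacFormBound k`: choose `m ≥ k` with
`physLevel (m+2) ≥ physLevel (k+1) + 96κ² + 3` (`tendsto_physLevel_atTop`), take the AL1 family at index `m` and the constraint
functions `fs_i = f_i` (`i < k`), and apply `flatKac_window`. [cite: SimonB1983DiscreteSpectrum, §3] -/
theorem flatKac_of_AL1 (hAL1 : ∀ k : ℕ, LuscherHamiltonianEigenfunctions k) (k : ℕ) : FlatKacFormBound k := by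
  intro κ hκ
  obtain ⟨N, hN⟩ := tendsto_atTop_atTop.1 tendsto_physLevel_atTop (physLevel (k + 1) + 96 * κ ^ 2 + 3)
  obtain ⟨f, hf⟩ := isEigenFamily_of_AL1 (max N k) (hAL1 (max N k))
  have hkm : k ≤ max N k + 1 := (le_max_right N k).trans (Nat.le_succ _)
  have hgap : physLevel (k + 1) + 96 * κ ^ 2 + 3 ≤ physLevel (max N k + 2) :=
    hN _ ((le_max_left N k).trans (Nat.le_add_right _ _))
  obtain ⟨C, t₀, ht₀, H⟩ := flatKac_window hf (k := k) hgap
  refine ⟨C, t₀, ht₀, fun i => f ⟨(i : ℕ), lt_of_lt_of_le i.2 hkm⟩, fun i => (hf.1 _ 0).continuous,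
    fun i => (hf.2.2.2.2 _).abs_le, fun i => hf.2.1 _, fun i => (isKacFn_of_isEigenFamily hf _).integrable,
    fun t ht htt₀ g hgm hgM hginv hsupp horth => H t ht htt₀ g hgm hgM hginv hsupp fun j hj => ?_⟩
  have h := horth ⟨(j : ℕ), hj⟩
  dsimp only at h
  rw [Fin.eta] at h
  exact h

/-- **The registered v12 stub `stub_flatKacAL1` (birth line of crux `OneSiteLevels`, FLAT lane), by name and signature:**
AL1 at every index gives the flat Kac-form bound `FlatKacFormBound k` on the inner ball for every `k`.
[cite: SimonB1983DiscreteSpectrum, §3] [cite: ReedSimonIV1978, Thm. XIII.64] -/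
theorem stub_flatKacAL1 : (∀ k : ℕ, LuscherHamiltonianEigenfunctions k) → ∀ k : ℕ, FlatKacFormBound k :=
  fun hAL1 k => flatKac_of_AL1 hAL1 k

end Assembly

end Summit.QuantumFields.YangMills.Theorems.FemtoTransferGap

end
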